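import Literature.MathematicalPhysics.QuantumLattice.GrassmannWardIdentity
import Literature.MathematicalPhysics.QuantumLattice.GrassmannParity

/-!
# Derivations on exponentials of even nilpotent Grassmann elements

Support for the seed Ward identity of crux stmt-14047 (line seed-ward-action): a (graded) derivation
`D` of the Grassmann algebra applied to the Boltzmann weight `e^{-g}` of an EVEN (hence central)
nilpotent `g` obeys the classical chain rule `D e^{-g} = -e^{-g} · D g`; instances: the charge
operator `N_q` and the left derivative `∂/∂ψ(X)`.
-/

set_option linter.dupNamespace false

namespace Summit.HubbardSuperconductivity.HubbardSuperconductivity.Theorems.AposterioriCapRgSeededBrokenRegimeBoseFermiPinned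

open Literature.MathematicalPhysics.QuantumLattice GrassmannAlgebra

/-- **Power rule for an even base**: a linear operator `D` obeying the Leibniz rule on left multiples
of an even (hence central) element `c` differentiates its powers classically,
`D (c^(n+1)) = (n+1) · c^n · D c`. [folklore] -/
theorem leibniz_pow_succ_of_mem_evenOdd_zero {Γ : Type}
    (D : GrassmannAlgebra ℂ Γ →ₗ[ℂ] GrassmannAlgebra ℂ Γ) {c : GrassmannAlgebra ℂ Γ}
    (hc : c ∈ GrassmannAlgebra.evenOdd ℂ 0) (hD : ∀ b, D (c * b) = D c * b + c * D b) (n : ℕ) :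
    D (c ^ (n + 1)) = ((n + 1 : ℕ) : ℂ) • (c ^ n * D c) := by
  induction n with
  | zero => rw [zero_add, pow_one, pow_zero, one_mul, Nat.cast_one, one_smul]
  | succ n ih =>
    rw [pow_succ' c (n + 1), hD, ih, ← (commute_of_mem_evenOdd_zero ℂ (pow_mem_evenOdd_zero ℂ hc (n + 1)) (D c)).eq,
      mul_smul_comm, ← mul_assoc, ← pow_succ', Nat.cast_succ (n + 1), add_smul, one_smul, add_comm]

/-- **Chain rule for the exponential of an even nilpotent**: a linear operator `D` with `D 1 = 0`
obeying the Leibniz rule on left multiples of an even nilpotent `c` satisfies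
`D e^{c} = e^{c} · D c` (`e^{c} = Σ_{i<k+1} cⁱ/i!` on the left, `Σ_{i<k} cⁱ/i!` on the right, `c^k = 0`).
[folklore] -/
theorem leibniz_grassmannExp_of_mem_evenOdd_zero {Γ : Type}
    (D : GrassmannAlgebra ℂ Γ →ₗ[ℂ] GrassmannAlgebra ℂ Γ) (hD1 : D 1 = 0) {c : GrassmannAlgebra ℂ Γ}
    (hc : c ∈ GrassmannAlgebra.evenOdd ℂ 0) (hn : IsNilpotent c)
    (hD : ∀ b, D (c * b) = D c * b + c * D b) :
    D (grassmannExp c) = grassmannExp c * D c := by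
  obtain ⟨k, hk⟩ := hn
  have hk1 : c ^ (k + 1) = 0 := by rw [pow_succ, hk, zero_mul]
  have hL : grassmannExp c = ∑ i ∈ Finset.range (k + 1), ((i.factorial : ℚ)⁻¹) • c ^ i :=
    IsNilpotent.exp_eq_sum hk1
  have hR : grassmannExp c = ∑ i ∈ Finset.range k, ((i.factorial : ℚ)⁻¹) • c ^ i :=
    IsNilpotent.exp_eq_sum hk
  conv_lhs => rw [hL, map_sum, Finset.sum_range_succ']
  conv_rhs => rw [hR, Finset.sum_mul]
  simp only [LinearMap.map_smul_of_tower, pow_zero, hD1, smul_zero, add_zero,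
    leibniz_pow_succ_of_mem_evenOdd_zero D hc hD, inv_factorial_succ_smul_succ_smul ℂ, smul_mul_assoc]

/-- **The charge operator on the Boltzmann weight of an even interaction**:
`N_q e^{-g} = -e^{-g} · N_q g` for `g` even and nilpotent (`N_q` is a derivation, `g` is central).
[folklore] -/
theorem chargeOp_grassmannExp_neg_of_mem_evenOdd_zero :
    ∀ {Γ : Type} [Fintype Γ] [DecidableEq Γ] (q : Γ → ℂ) {g : GrassmannAlgebra ℂ Γ}, g ∈ GrassmannAlgebra.evenOdd ℂ 0 →
      IsNilpotent g → chargeOp ℂ q (grassmannExp (-g)) = -(grassmannExp (-g) * chargeOp ℂ q g) := by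
  intro Γ _ _ q g hg hn
  rw [leibniz_grassmannExp_of_mem_evenOdd_zero (chargeOp ℂ q) (chargeOp_one ℂ q) (Submodule.neg_mem _ hg) hn.neg
      (fun b => chargeOp_mul ℂ q (-g) b), map_neg, mul_neg]

/-- **The left derivative of the Boltzmann weight of an even interaction**:
`∂_X e^{-g} = -e^{-g} · ∂_X g` for `g` even and nilpotent (the graded Leibniz rule is the plain one
on the even factor `-g`, which is central). [folklore] -/
theorem grassmannDeriv_grassmannExp_neg_of_mem_evenOdd_zero :
    ∀ {Γ : Type} (X : Γ) {g : GrassmannAlgebra ℂ Γ}, g ∈ GrassmannAlgebra.evenOdd ℂ 0 → IsNilpotent g →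
      grassmannDeriv ℂ X (grassmannExp (-g)) = -(grassmannExp (-g) * grassmannDeriv ℂ X g) := by
  intro Γ X g hg hn
  have hng : -g ∈ GrassmannAlgebra.evenOdd ℂ 0 := Submodule.neg_mem _ hg
  rw [leibniz_grassmannExp_of_mem_evenOdd_zero (grassmannDeriv ℂ X) (grassmannDeriv_one ℂ X) hng hn.neg
      (fun b => grassmannDeriv_mul_of_involute_eq ℂ X (CliffordAlgebra.involute_eq_of_mem_even hng) b),
    map_neg, mul_neg]

end Summit.HubbardSuperconductivity.HubbardSuperconductivity.Theorems.AposterioriCapRgSeededBrokenRegimeBoseFermiPinned
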